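import Mathlib
import HarnessLib

/-!
# The heavy-output constant `(1 + ln 2)/2` of the exponential (Porter–Thomas) model (Aaronson–Chen 2017)

Source. S. Aaronson, L. Chen, *Complexity-theoretic foundations of quantum supremacy experiments*,
CCC 2017 (LIPIcs 79) = arXiv:1612.05903 [AaronsonChen2017] (held text read: p0006, p0014, p0043).
§3.1 (p0014): "we say that an output `z ∈ {0,1}ⁿ` is heavy for a quantum circuit `C`, if it is
greater than the median of `probs(C|0ⁿ⟩)`" and "`adv(C)` is simply the probability that `z` is heavy
for `C`" for the ideal sampler; §1 footnote (p0006): "Heuristically, one expects the `p_{x_i}`'s to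
be exponentially distributed random variables, which one can calculate implies that a roughly
`(1 + ln 2)/2 ≈ 0.847` fraction of the outputs will have probabilities exceeding the median value";
Appendix "Numerical simulation for Conjecture 1" (p0043): "`C_thr := (1 + ln 2)/2`. … the values
`2ⁿ·|⟨x|C|0⟩|²` … are distributed very closely to `2ⁿ` i.i.d. exponential distributions with
`λ = 1`. So, assuming that, we can see that the median of `probs(C|0⟩)` concentrates around `ln 2`,
as `∫₀^{ln 2} dx e^{−x} = 1/2`, which also implies that `adv(C)` concentrates around
`∫_{ln 2}^{+∞} x e^{−x} dx = C_thr = (1 + ln 2)/2 ≈ 0.846574`."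

HONEST FRAMING: instance-level adjudication of specific advantage claims; no claim about BQP vs BPP
or the summit. What is proved is ONLY the calculus behind the printed constant — the two integrals
of the unit-rate exponential law (the "Porter–Thomas" model of ideal output probabilities): its
median is `ln 2` and the mass-weighted tail above the median is `(1 + ln 2)/2` — together with the
general threshold forms `∫_t^∞ e^{−x} dx = e^{−t}` and `∫_t^∞ x e^{−x} dx = (t + 1) e^{−t}`. That
real devices or random circuits follow this model (Aaronson–Chen's Conjecture 1; the `2/3`
pass threshold of HOG / quantum-volume tests) is an assumption of the primaries and is NOT asserted.
Def-free; 0 facts.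

What is here: `integral_exp_neg_Ioi'` (`∫_{t}^{∞} e^{−x} dx = e^{−t}`, Mathlib's
`integral_exp_neg_Ioi` restated), **`integral_exp_neg_zero_log_two`** (`∫₀^{ln 2} e^{−x} dx = ½`:
`ln 2` is the median), `integral_exp_neg_Ioi_log_two` (the upper half also has mass `½`),
`hasDerivAt_neg_add_one_mul_exp_neg` (the antiderivative `−((x+1)e^{−x})` of `x e^{−x}`),
**`integral_id_mul_exp_neg_Ioi`** (`∫_t^∞ x e^{−x} dx = (t+1)e^{−t}` for `t ≥ 0`) and
**`heavyOutput_constant`** (`∫_{ln 2}^∞ x e^{−x} dx = (1 + ln 2)/2`), with the numerical sandwich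
`heavyOutput_constant_bounds` (`0.84 < (1 + ln 2)/2 < 0.85`).
-/

namespace Literature.Computability.QuantumComplexity.HeavyOutput

open Real MeasureTheory Set Filter Topology

/-- [cite: AaronsonChen2017, Appendix "Numerical simulation for Conjecture 1" (the exponential model, `λ = 1`) (held text p0043)]
Tail mass of the unit exponential law: `∫_t^∞ e^{−x} dx = e^{−t}` (Mathlib `integral_exp_neg_Ioi`). -/
theorem integral_exp_neg_Ioi' (t : ℝ) : ∫ x in Ioi t, exp (-x) = exp (-t) :=
  integral_exp_neg_Ioi t

/-- [cite: AaronsonChen2017, Appendix "Numerical simulation for Conjecture 1" ("the median of probs(C|0⟩) concentrates around ln 2, as ∫₀^{ln 2} dx e^{−x} = 1/2") (held text p0043)]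
**`ln 2` is the median of the unit exponential law**: `∫₀^{ln 2} e^{−x} dx = ½`. -/
theorem integral_exp_neg_zero_log_two : ∫ x in (0 : ℝ)..log 2, exp (-x) = 1 / 2 := by
  rw [intervalIntegral.integral_comp_neg fun x => exp x, neg_zero, integral_exp, exp_zero, exp_neg,
    exp_log two_pos]
  norm_num

/-- [cite: AaronsonChen2017, §3.1 (heavy outputs = those above the median) and Appendix "Numerical simulation for Conjecture 1" (held text p0014, p0043)]
The upper half: `∫_{ln 2}^∞ e^{−x} dx = ½` (half of the unit-exponential draws exceed `ln 2`). -/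
theorem integral_exp_neg_Ioi_log_two : ∫ x in Ioi (log 2), exp (-x) = 1 / 2 := by
  rw [integral_exp_neg_Ioi, exp_neg, exp_log two_pos]
  norm_num

/-- [cite: AaronsonChen2017, Appendix "Numerical simulation for Conjecture 1" (∫ x e^{−x} dx) (held text p0043)]
The antiderivative used for `∫ x e^{−x}`: `d/dx (−((x+1) e^{−x})) = x e^{−x}`. -/
theorem hasDerivAt_neg_add_one_mul_exp_neg (x : ℝ) :
    HasDerivAt (fun y : ℝ => -((y + 1) * exp (-y))) (x * exp (-x)) x := by
  have h1 : HasDerivAt (fun y : ℝ => y + 1) 1 x := (hasDerivAt_id x).add_const 1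
  have h2 : HasDerivAt (fun y : ℝ => exp (-y)) (exp (-x) * -1) x := (hasDerivAt_neg x).exp
  refine ((h1.mul h2).neg).congr_deriv ?_
  ring

/-- [cite: AaronsonChen2017, Appendix "Numerical simulation for Conjecture 1" ("∫_{ln 2}^{+∞} x e^{−x} dx = C_thr", the general threshold form) (held text p0043)]
**Mass-weighted tail of the unit exponential law**: `∫_t^∞ x e^{−x} dx = (t + 1) e^{−t}` for
`t ≥ 0` (the expected ideal-probability mass carried by the outputs whose scaled probability
exceeds `t`). -/
theorem integral_id_mul_exp_neg_Ioi {t : ℝ} (ht : 0 ≤ t) :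
    ∫ x in Ioi t, x * exp (-x) = (t + 1) * exp (-t) := by
  have hlim : Tendsto (fun y : ℝ => -((y + 1) * exp (-y))) atTop (𝓝 0) := by
    have h1 : Tendsto (fun y : ℝ => y ^ (1 : ℕ) * exp (-y)) atTop (𝓝 0) :=
      tendsto_pow_mul_exp_neg_atTop_nhds_zero 1
    have h2 : Tendsto (fun y : ℝ => exp (-y)) atTop (𝓝 0) := tendsto_exp_neg_atTop_nhds_zero
    have h := (h1.add h2).neg
    rw [add_zero, neg_zero] at h
    refine h.congr fun y => ?_
    ring
  rw [integral_Ioi_of_hasDerivAt_of_nonneg' (fun x _ => hasDerivAt_neg_add_one_mul_exp_neg x)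
    (fun x hx => mul_nonneg (ht.trans (le_of_lt hx)) (exp_pos _).le) hlim]
  ring

/-- [cite: AaronsonChen2017, §1 footnote ("a roughly (1+ln 2)/2 ≈ 0.847 fraction of the outputs will have probabilities exceeding the median value") and Appendix "Numerical simulation for Conjecture 1" ("∫_{ln 2}^{+∞} x e^{−x} dx = C_thr = (1 + ln 2)/2 ≈ 0.846574") (held text p0006, p0043)]
**The heavy-output constant**: under the unit exponential (Porter–Thomas) model the ideal sampler's
probability of a heavy output is `∫_{ln 2}^∞ x e^{−x} dx = (1 + ln 2)/2`. -/
theorem heavyOutput_constant : ∫ x in Ioi (log 2), x * exp (-x) = (1 + log 2) / 2 := by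
  rw [integral_id_mul_exp_neg_Ioi (log_nonneg one_le_two), exp_neg, exp_log two_pos]
  ring

/-- [cite: AaronsonChen2017, Appendix "Numerical simulation for Conjecture 1" ("C_thr = (1 + ln 2)/2 ≈ 0.846574") (held text p0043)]
Numerical sandwich for the constant: `0.84 < (1 + ln 2)/2 < 0.85` (from Mathlib's
`0.6931471803 < ln 2 < 0.6931471808`). -/
theorem heavyOutput_constant_bounds : (0.84 : ℝ) < (1 + log 2) / 2 ∧ (1 + log 2) / 2 < 0.85 := by
  constructor
  · have := log_two_gt_d9
    linarith
  · have := log_two_lt_d9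
    linarith

end Literature.Computability.QuantumComplexity.HeavyOutput
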